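import Literature.NumberTheory.EllipticCurves.NewformSymmSquareJ1728Hecke
import HarnessLib

/-!
# The parameter `d_W = (cube-free part of Δ_min) · (2N)³` of the Grössencharacter of a `j = 0` curve

Helper file for the crux `PeterssonLowerBound` (stmt-ABC-10870), stub `stub_j0`. For a globally minimal
`W/ℚ` (with `j(W) = 0`) and its conductor `N`, the symmetric-square `L`-function is compared with the
Hecke `L`-function of `ν_W = ν_{d,1,2}` (`EisensteinGrossencharacterSums.grossenNu`) at an integer
parameter `d` which must (i) have the same cubic residue symbols as the minimal discriminant `Δ_min` at
the good primes, (ii) be such that `3d` is divisible by every prime of `6N` and by no other prime, so that `ν_W` is trivialised exactly at the primes of `6N`, and (iii) be polynomially bounded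
in `N` (the conductor of `ν_W` enters the lower bound `|L(1, ν_W)| ≫ (log Q)⁻³`). We take
`d = sign(Δ) Δ' · (2N)³` with `|Δ_min| = Δ' · c³`, `Δ' = ∏_{p ∣ Δ} p^{v_p(Δ) mod 3} ≤ rad(Δ_min)² ≤ N²`, which
gives `|d| ≤ 8 N⁵`. Everything is proved and no definition is introduced: the outcome is the existence
statement `IsNewformOf.exists_dJ0` (pure integer arithmetic plus the fact that the primes of `Δ_min` divide `N`).

[folklore]
-/

noncomputable section

set_option linter.dupNamespace false

open WeierstrassCurve CongruenceSubgroup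
open Literature.NumberTheory.EllipticCurves.ModularForms

namespace Summit.ABC.ABC.Theorems.PeterssonJ0

/-! ### Cube-free reduction of a natural number -/

/-- **`n = Δ'(n) · c(n)³`** with `Δ'(n) = ∏_{p ∣ n} p^{v_p(n) mod 3}`, `c(n) = ∏_{p ∣ n} p^{⌊v_p(n)/3⌋}`, for
`n ≠ 0`. [folklore] -/
theorem prod_pow_mod_mul_prod_pow_div_pow {n : ℕ} (hn : n ≠ 0) :
    (Finset.prod n.primeFactors fun q ↦ q ^ (n.factorization q % 3)) *
      (Finset.prod n.primeFactors fun q ↦ q ^ (n.factorization q / 3)) ^ 3 = n := by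
  conv_rhs => rw [← Nat.prod_factorization_pow_eq_self hn]
  rw [Finsupp.prod, Nat.support_factorization, ← Finset.prod_pow, ← Finset.prod_mul_distrib]
  refine Finset.prod_congr rfl fun p _ ↦ ?_
  rw [← pow_mul, ← pow_add]
  congr 1
  omega

/-- **`Δ'(n) ≤ rad(n)²`.** [folklore] -/
theorem prod_pow_mod_le (n : ℕ) :
    (Finset.prod n.primeFactors fun q ↦ q ^ (n.factorization q % 3)) ≤ (∏ p ∈ n.primeFactors, p) ^ 2 := by
  rw [← Finset.prod_pow]
  refine Finset.prod_le_prod' fun q hq ↦ ?_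
  exact Nat.pow_le_pow_right (Nat.prime_of_mem_primeFactors hq).pos (Nat.le_of_lt_succ (Nat.mod_lt _ three_pos))

/-- The radical of `n` is at most any `m ≠ 0` whose prime factors contain those of `n`. [folklore] -/
theorem prod_primeFactors_le {n m : ℕ} (h : n.primeFactors ⊆ m.primeFactors) (hm : m ≠ 0) :
    ∏ p ∈ n.primeFactors, p ≤ m :=
  (Finset.prod_le_prod_of_subset_of_one_le' h fun _ hp _ ↦ (Nat.prime_of_mem_primeFactors hp).one_lt.le).trans
    (Nat.le_of_dvd (Nat.pos_of_ne_zero hm) (Nat.prod_primeFactors_dvd m))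

/-! ### The minimal discriminant and the bad primes -/

section MinDisc

variable {W : WeierstrassCurve ℚ} [W.IsElliptic] [W.IsGloballyMinimal] {N : ℕ} [NeZero N]
  {f : CuspForm (Gamma0 N) 2}

/-- The primes of `Δ_min` divide `N` (bad reduction). [folklore] -/
theorem IsNewformOf.primeFactors_natAbs_minimalDiscriminantInt_subset (hf : IsNewformOf W f) :
    W.minimalDiscriminantInt.natAbs.primeFactors ⊆ N.primeFactors := by
  intro p hp
  obtain ⟨hpp, hpd, -⟩ := Nat.mem_primeFactors.mp hp
  haveI : Fact p.Prime := ⟨hpp⟩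
  refine Nat.mem_primeFactors.mpr ⟨hpp, ?_, NeZero.ne N⟩
  by_contra hpN
  exact (hf.not_dvd_minimalDiscriminantInt_of_not_dvd hpN).2 (Int.natCast_dvd.mpr hpd)

end MinDisc

/-! ### The parameter `d_W` -/

/-- **The parameter of the Grössencharacter of a `j = 0` curve.** For a globally minimal `W/ℚ` and its
newform `f ∈ S₂(Γ₀(N))` there is `d ∈ ℤ`, `d ≠ 0`, with `|d| ≤ 8N⁵`, `p ∣ 6N ⇒ p ∣ 3d`,
`p ∤ 6N ⇒ p ∤ 3d`, and `d c³ = Δ_min t³` for integers `c, t` prime to every `p ∤ 6N` (so that `d` and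
`Δ_min` have the same cubic residue symbols at the good primes); namely `d = sign(Δ_min) Δ' (2N)³`,
`|Δ_min| = Δ' c³` the cube-free reduction, `t = 2N`. [folklore] -/
theorem IsNewformOf.exists_dJ0 {W : WeierstrassCurve ℚ} [W.IsElliptic] [W.IsGloballyMinimal] {N : ℕ} [NeZero N]
    {f : CuspForm (Gamma0 N) 2} (hf : IsNewformOf W f) :
    ∃ d c t : ℤ, d ≠ 0 ∧ d.natAbs ≤ 8 * N ^ 5 ∧
      (∀ p : ℕ, p.Prime → p ∣ 6 * N → (p : ℤ) ∣ 3 * d) ∧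
      (∀ p : ℕ, p.Prime → ¬ p ∣ 6 * N → ¬ (p : ℤ) ∣ 3 * d ∧ IsCoprime (p : ℤ) c ∧ IsCoprime (p : ℤ) t) ∧
      d * c ^ 3 = W.minimalDiscriminantInt * t ^ 3 := by
  set Δ : ℤ := W.minimalDiscriminantInt with hΔdef
  have hΔ0 : Δ ≠ 0 := W.minimalDiscriminantInt_ne_zero
  have hn : Δ.natAbs ≠ 0 := Int.natAbs_ne_zero.mpr hΔ0
  set A : ℕ := Finset.prod Δ.natAbs.primeFactors fun q ↦ q ^ (Δ.natAbs.factorization q % 3) with hA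
  set c : ℕ := Finset.prod Δ.natAbs.primeFactors fun q ↦ q ^ (Δ.natAbs.factorization q / 3) with hc
  have hAc : A * c ^ 3 = Δ.natAbs := prod_pow_mod_mul_prod_pow_div_pow hn
  have hA0 : A ≠ 0 := fun h ↦ hn (by rw [← hAc, h, zero_mul])
  have hAdvd : A ∣ Δ.natAbs := ⟨c ^ 3, hAc.symm⟩
  have hcdvd : (c : ℤ) ∣ Δ := Int.natCast_dvd.mpr ⟨A * c ^ 2, by rw [← hAc]; ring⟩
  set t : ℤ := ((2 * N : ℕ) : ℤ) with ht
  set d : ℤ := Δ.sign * A * t ^ 3 with hd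
  have ht0 : t ≠ 0 := by rw [ht]; exact_mod_cast Nat.mul_ne_zero two_ne_zero (NeZero.ne N)
  -- `d c³ = Δ t³` and `|d| = A (2N)³`
  have hdc : d * (c : ℤ) ^ 3 = Δ * t ^ 3 := by
    have key : ((A : ℕ) : ℤ) * ((c : ℕ) : ℤ) ^ 3 = Δ.natAbs := by exact_mod_cast hAc
    have hs := Int.sign_mul_natAbs Δ
    rw [hd]
    linear_combination (t ^ 3 * Δ.sign : ℤ) * key + (t ^ 3 : ℤ) * hs
  have hdabs : d.natAbs = A * (2 * N) ^ 3 := by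
    rw [hd, Int.natAbs_mul, Int.natAbs_mul, Int.natAbs_sign_of_ne_zero hΔ0, one_mul, Int.natAbs_natCast,
      Int.natAbs_pow, ht, Int.natAbs_natCast]
  -- the divisibility pattern of `3d`
  have hdvd6 : ∀ p : ℕ, p.Prime → p ∣ 6 * N → (p : ℤ) ∣ 3 * d := by
    intro p hp h
    have h6 : p ∣ 3 * (2 * N) := by rw [← mul_assoc]; exact h
    rcases (Nat.Prime.dvd_mul hp).mp h6 with h3 | h2N
    · have hp3 : p = 3 := (Nat.prime_dvd_prime_iff_eq hp Nat.prime_three).mp h3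
      subst hp3
      exact Dvd.intro _ rfl
    · have hZ : (p : ℤ) ∣ t := Int.natCast_dvd_natCast.mpr h2N
      rw [hd, ← mul_assoc]
      exact Dvd.dvd.mul_left (hZ.trans (dvd_pow_self _ three_ne_zero)) _
  have hndvd : ∀ p : ℕ, p.Prime → ¬ p ∣ 6 * N → ¬ (p : ℤ) ∣ 3 * d ∧ ¬ (p : ℤ) ∣ c ∧ ¬ (p : ℤ) ∣ t := by
    intro p hp h
    haveI : Fact p.Prime := ⟨hp⟩
    have hp' : Prime (p : ℤ) := Nat.prime_iff_prime_int.mp hp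
    have h3 : ¬ p ∣ 3 := fun h3 ↦ h (h3.trans ⟨2 * N, by ring⟩)
    have h2N : ¬ p ∣ 2 * N := fun h2 ↦ h (h2.trans ⟨3, by ring⟩)
    have hN : ¬ p ∣ N := fun hN ↦ h2N (Dvd.dvd.mul_left hN 2)
    have hΔp := (hf.not_dvd_minimalDiscriminantInt_of_not_dvd hN).2
    have hpt : ¬ (p : ℤ) ∣ t := fun h' ↦ h2N (Int.natCast_dvd_natCast.mp (by rwa [ht] at h'))
    refine ⟨fun hdvd ↦ ?_, fun hpc ↦ hΔp (hpc.trans hcdvd), hpt⟩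
    rcases hp'.dvd_or_dvd hdvd with h' | h'
    · exact h3 (Int.natCast_dvd_natCast.mp h')
    have hnat : p ∣ d.natAbs := Int.natCast_dvd.mp h'
    rw [hdabs] at hnat
    rcases (Nat.Prime.dvd_mul hp).mp hnat with h'' | h''
    · exact hΔp (Int.natCast_dvd.mpr (h''.trans hAdvd))
    · exact h2N (hp.dvd_of_dvd_pow h'')
  refine ⟨d, c, t, ?_, ?_, hdvd6, fun p hp h ↦ ?_, hdc⟩
  · -- `d ≠ 0`
    rw [hd]
    refine mul_ne_zero (mul_ne_zero (fun h0 ↦ hΔ0 (Int.sign_eq_zero_iff_zero.mp h0)) ?_) (pow_ne_zero 3 ht0)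
    exact_mod_cast hA0
  · -- `|d| ≤ 8 N⁵`
    rw [hdabs]
    have h1 : A ≤ N ^ 2 := (prod_pow_mod_le _).trans (Nat.pow_le_pow_left
      (prod_primeFactors_le (IsNewformOf.primeFactors_natAbs_minimalDiscriminantInt_subset hf) (NeZero.ne N)) 2)
    calc A * (2 * N) ^ 3 ≤ N ^ 2 * (2 * N) ^ 3 := Nat.mul_le_mul_right _ h1
      _ = 8 * N ^ 5 := by ring
  · -- coprimality at `p ∤ 6N`
    have hp' : Prime (p : ℤ) := Nat.prime_iff_prime_int.mp hp
    obtain ⟨h3d, hpc, hpt⟩ := hndvd p hp h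
    exact ⟨h3d, hp'.irreducible.coprime_iff_not_dvd.mpr hpc, hp'.irreducible.coprime_iff_not_dvd.mpr hpt⟩

end Summit.ABC.ABC.Theorems.PeterssonJ0

namespace Summit.ABC.ABC.Theorems

/-- **Registered sub-goal `stub_j0_data` of stub `stub_j0`** (crux stmt-ABC-10870): the cube-free
reduction `n = Δ'(n) c(n)³` of a natural number. [folklore] -/
theorem stub_j0_data : ∀ n : ℕ, n ≠ 0 → (Finset.prod n.primeFactors fun q ↦ q ^ (n.factorization q % 3)) * (Finset.prod n.primeFactors fun q ↦ q ^ (n.factorization q / 3)) ^ 3 = n :=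
  fun _ hn ↦ PeterssonJ0.prod_pow_mod_mul_prod_pow_div_pow hn

end Summit.ABC.ABC.Theorems

end
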